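import Mathlib.Analysis.SpecialFunctions.Pow.Real
import Mathlib.Analysis.SpecialFunctions.Log.Basic
import Mathlib.Analysis.SpecialFunctions.Exp
import Mathlib.MeasureTheory.Integral.IntervalIntegral.Basic
import Literature.NumberTheory.LFunctions.DobnerLemma4Tools
import HarnessLib

/-!
# Rodgers–Tao 2020, proof of Proposition 15 (FMP pp. 38–39): the pigeonhole, monotonicity and
crude-lower-bound skeleton — stage S2 of the P6.1 content twin

RH-FREE literature PROOFS (no definitions, no named facts). Trunk T-ANT
(`Literature/NumberTheory/LFunctions`); stage **S2** of rt-lead ruling (50) (rt/STATUS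
2026-08-26) for rt-t4's `RodgersTaoWeakEnergyBoundProofs.lean` (the content twin of
`rodgers_tao_weak_energy_bound`, B. Rodgers, T. Tao, *The de Bruijn–Newman constant is
non-negative*, Forum Math. Pi 8 (2020) e6 = arXiv:1801.05914, Proposition 15 «Weak bound on
integrated energy», proof FMP pp. 38–39 = v5 TeX l.950–977).

The lemmas are stated ABSTRACTLY (functions `ℕ → ℝ`, `Finset` sums), so that this module has no
interface with the S1 definitions (`Q_I`, the cross terms); the assembly instantiates them.

> (FMP p. 38 = v5 TeX l.953–962, verbatim) «For any discrete interval `I`, let `Q_I` denote the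
> quantity `Q_I := ∫_{Λ/2}^0 Σ_{j,k ∈ I: j ≠ k} E_{jk}(t) dt`. From (add) we have a crude lower bound
> `Q_{[J,2J]_{ℤ*}} ≫ J log^{−O(1)} J` while from Proposition 14 we have an extremely crude upper
> bound `Q_{[0.5J,3J]_{ℤ*}} ≪ exp(O(log² J log log J))`. The ratio between `Q_{[0.5J,3J]_{ℤ*}}` and
> `Q_{[J,2J]_{ℤ*}}` is thus less than `(1 + J^{−0.1})^{0.5J/J^{0.1}}`. By the pigeonhole principle,
> we can then therefore find an interval `K := [J₋,J₊]_{ℤ*}` containing `[J,2J]_{ℤ*}` and contained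
> in `[0.5J + J^{0.1}, 3J − J^{0.1}]_{ℤ*}`, such that `Q_{K′} ≤ (1 + J^{−0.1}) Q_K` (pig), where
> `K′ := [J₋ − J^{0.1}, J₊ + J^{0.1}]_{ℤ*}` is a slight enlargement of `K`.»

## Main results

* (i) ratio pigeonhole: `exists_succ_le_mul_of_le_pow_mul` (`f m ≤ ρ^m f 0 ⇒ ∃ i < m,
  f (i+1) ≤ ρ f i`, no sign or monotonicity hypothesis), `exists_succ_le_rpow_one_div_mul` (`R^{1/m}`
  form), `exists_succ_le_add_div` (additive form), `exists_succ_le_one_add_mul` (the printed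
  bookkeeping: `exp B ≤ (1+ε)^m`), `exists_succ_le_one_add_mul_of_lt_pow` (the assembly form), with the growth lemmas `exp_half_mul_le_one_add_pow` and
  `eventually_exp_log_sq_mul_loglog_le_one_add_rpow_pow` (`ε = J^{−0.1}`, `m ≥ c J^{0.9}` steps);
* (ii) monotonicity of `K ↦ Σ_{k ≠ k′ ∈ K} g k k′` in `K` for `g ≥ 0`:
  `Finset.sum_offDiag_le_sum_offDiag_of_subset`, `Finset.sum_offDiag_mono_of_nonneg` (+ product-filter
  and `k < k′` variants and the interval-integral version);
* (iii) crude lower-bound skeleton: `Finset.card_div_sq_le_sum_inv_sq` (gaps `0 < d_k ≤ G` on a set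
  `S` of indices ⇒ `|S|/G² ≤ Σ_{k∈S} d_k^{−2}`) and its integrated form.

LABEL: RH-FREE CONTENT (0 facts). bears_on: N-C/N-P (COLUMN 3 DBN).
WHAT THIS IS NOT: bookkeeping for Rodgers–Tao's RH-free integrated-energy bound, whose printed
`Λ/2 ≤ t ≤ 0` instance is VACUOUS-AS-PRINTED (`Λ ≥ 0` is a kernel theorem); nothing here bears
on the truth of RH.
-/

noncomputable section

open Real Filter Set Topology Finset MeasureTheory

namespace Literature.NumberTheory.LFunctions

/-! ## (i) The ratio pigeonhole -/

/-- **Ratio pigeonhole** (the «pigeonhole principle» of FMP p. 38): if `f m ≤ ρ^m · f 0` with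
`ρ > 0` and `m ≥ 1`, then some consecutive pair satisfies `f (i+1) ≤ ρ · f i` (`i < m`).
No sign or monotonicity hypothesis on `f` is needed (if every step grew by more than the factor
`ρ`, then `f m > ρ^m f 0`). [cite: RodgersTaoFMP2020, §8 proof of Prop. 15, FMP p. 38 («By the
pigeonhole principle …» = eq. (pig))] -/
theorem exists_succ_le_mul_of_le_pow_mul {f : ℕ → ℝ} {ρ : ℝ} {m : ℕ} (hρ : 0 < ρ) (hm : 0 < m)
    (h : f m ≤ ρ ^ m * f 0) : ∃ i < m, f (i + 1) ≤ ρ * f i := by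
  by_contra hcon
  push Not at hcon
  -- every step grows by more than `ρ`: `f k > ρ^k f 0` for `1 ≤ k ≤ m`
  have key : ∀ k : ℕ, 1 ≤ k → k ≤ m → ρ ^ k * f 0 < f k := by
    intro k hk hkm
    induction k with
    | zero => omega
    | succ n ih =>
      rcases Nat.eq_zero_or_pos n with rfl | hn
      · simpa using hcon 0 hm
      · have h1 : ρ ^ n * f 0 < f n := ih hn (by omega)
        have h2 : ρ * f n < f (n + 1) := hcon n (by omega)
        calc ρ ^ (n + 1) * f 0 = ρ * (ρ ^ n * f 0) := by ring
          _ < ρ * f n := mul_lt_mul_of_pos_left h1 hρ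
          _ < f (n + 1) := h2
  exact absurd h (not_le.2 (key m hm le_rfl))

/-- `R^{1/m}` form of the ratio pigeonhole: `f m ≤ R · f 0`, `R > 0`, `m ≥ 1` ⇒
`∃ i < m, f (i+1) ≤ R^{1/m} · f i`.
[cite: RodgersTaoFMP2020, §8 proof of Prop. 15, FMP p. 38 (eq. (pig))] -/
theorem exists_succ_le_rpow_one_div_mul {f : ℕ → ℝ} {R : ℝ} {m : ℕ} (hR : 0 < R) (hm : 0 < m)
    (h : f m ≤ R * f 0) : ∃ i < m, f (i + 1) ≤ R ^ (1 / (m : ℝ)) * f i := by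
  refine exists_succ_le_mul_of_le_pow_mul (Real.rpow_pos_of_pos hR _) hm ?_
  have hm' : (m : ℝ) ≠ 0 := Nat.cast_ne_zero.2 hm.ne'
  rwa [← Real.rpow_natCast, ← Real.rpow_mul hR.le, one_div_mul_cancel hm', Real.rpow_one]

/-- Additive form of the pigeonhole: `g m ≤ g 0 + D`, `m ≥ 1` ⇒ `∃ i < m, g (i+1) ≤ g i + D/m`.
[cite: RodgersTaoFMP2020, §8 proof of Prop. 15, FMP p. 38 (eq. (pig), logarithmic form)] -/
theorem exists_succ_le_add_div {g : ℕ → ℝ} {D : ℝ} {m : ℕ} (hm : 0 < m) (h : g m ≤ g 0 + D) :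
    ∃ i < m, g (i + 1) ≤ g i + D / m := by
  by_contra hcon
  push Not at hcon
  have key : ∀ k : ℕ, k ≤ m → g 0 + k * (D / m) ≤ g k ∧ (1 ≤ k → g 0 + k * (D / m) < g k) := by
    intro k hkm
    induction k with
    | zero => simp
    | succ n ih =>
      have h1 : g 0 + n * (D / m) ≤ g n := (ih (by omega)).1
      have h2 : g n + D / m < g (n + 1) := hcon n (by omega)
      constructor
      · push_cast; linarith
      · intro; push_cast; linarith
  have hm' : (m : ℝ) ≠ 0 := Nat.cast_ne_zero.2 hm.ne'
  have := (key m le_rfl).2 hm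
  rw [mul_div_cancel₀ _ hm'] at this
  linarith

/-- **The printed bookkeeping**: if the total ratio `f m / f 0` is at most `exp B` and
`exp B ≤ (1+ε)^m` (in the paper: `exp(O(log² J log log J)) ≤ (1 + J^{−0.1})^{0.5J/J^{0.1}}`),
then some consecutive pair has `f (i+1) ≤ (1+ε) f i` — this is eq. (pig)
`Q_{K′} ≤ (1 + J^{−0.1}) Q_K`. Needs `f 0 ≥ 0`.
[cite: RodgersTaoFMP2020, §8 proof of Prop. 15, FMP p. 38 (eq. (pig))] -/
theorem exists_succ_le_one_add_mul {f : ℕ → ℝ} {ε B : ℝ} {m : ℕ} (hε : 0 < ε) (hm : 0 < m)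
    (hB : Real.exp B ≤ (1 + ε) ^ m) (h0 : 0 ≤ f 0) (h : f m ≤ Real.exp B * f 0) :
    ∃ i < m, f (i + 1) ≤ (1 + ε) * f i :=
  exists_succ_le_mul_of_le_pow_mul (by linarith) hm (h.trans (mul_le_mul_of_nonneg_right hB h0))

/-- **t4's assembly form** of the ratio pigeonhole (rt/STATUS 2026-08-26T11:13:53Z): for
`q 0 > 0`, `q m ≤ R · q 0` and `R < (1+η)^m` (`η > 0`), some consecutive pair has
`q (i+1) ≤ (1+η) · q i`. (Monotonicity of `q` is not needed; `m = 0` is excluded by the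
hypotheses themselves.) [cite: RodgersTaoFMP2020, §8 proof of Prop. 15, FMP p. 38 (eq. (pig))] -/
theorem exists_succ_le_one_add_mul_of_lt_pow {q : ℕ → ℝ} {m : ℕ} {R η : ℝ} (h0 : 0 < q 0)
    (hR : q m ≤ R * q 0) (hη : 0 < η) (hgrow : R < (1 + η) ^ m) :
    ∃ i, i < m ∧ q (i + 1) ≤ (1 + η) * q i := by
  rcases Nat.eq_zero_or_pos m with rfl | hm
  · -- `m = 0`: `q 0 ≤ R q 0` with `q 0 > 0` forces `1 ≤ R`, contradicting `R < 1`
    exfalso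
    rw [pow_zero] at hgrow
    nlinarith
  · obtain ⟨i, hi, h⟩ := exists_succ_le_mul_of_le_pow_mul (f := q) (by linarith : (0 : ℝ) < 1 + η) hm
      (hR.trans (mul_le_mul_of_nonneg_right hgrow.le h0.le))
    exact ⟨i, hi, h⟩

/-- Growth lemma: `exp(m·u/2) ≤ (1+u)^m` for `0 ≤ u ≤ 1` (from `exp(u/2) ≤ 1 + u/2 + u²/4 ≤ 1 + u`)
— the elementary inequality behind the comparison `exp(O(log² J log log J)) <
(1 + J^{−0.1})^{0.5J/J^{0.1}}` of FMP p. 38.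
[cite: RodgersTaoFMP2020, §8 proof of Prop. 15, FMP p. 38 (ratio comparison before eq. (pig))] -/
theorem exp_half_mul_le_one_add_pow {u : ℝ} (hu0 : 0 ≤ u) (hu1 : u ≤ 1) (m : ℕ) :
    Real.exp (m * u / 2) ≤ (1 + u) ^ m := by
  have h1 : Real.exp (u / 2) ≤ 1 + u := by
    have hb := Real.abs_exp_sub_one_sub_id_le (x := u / 2) (by rw [abs_of_nonneg (by linarith)]; linarith)
    have := (abs_le.1 hb).2
    nlinarith
  calc Real.exp (m * u / 2) = Real.exp (u / 2) ^ m := by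
        rw [← Real.exp_nat_mul]; ring_nf
    _ ≤ (1 + u) ^ m := pow_le_pow_left₀ (Real.exp_pos _).le h1 m

/-- Growth lemma, printed instance: for every `A` and `c > 0`, for all large `J` and every
`m ≥ c · J^{0.9}`, `exp(A log² J · log log J) ≤ (1 + J^{−0.1})^m` («The ratio between
`Q_{[0.5J,3J]_{ℤ*}}` and `Q_{[J,2J]_{ℤ*}}` is thus less than `(1 + J^{−0.1})^{0.5J/J^{0.1}}`»,
FMP p. 38).
[cite: RodgersTaoFMP2020, §8 proof of Prop. 15, FMP p. 38] -/
theorem eventually_exp_log_sq_mul_loglog_le_one_add_rpow_pow (A c : ℝ) (hc : 0 < c) :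
    ∀ᶠ J : ℝ in atTop, ∀ m : ℕ, c * J ^ (9 / 10 : ℝ) ≤ m →
      Real.exp (A * Real.log J ^ 2 * Real.log (Real.log J)) ≤ (1 + J ^ (-(1 / 10 : ℝ))) ^ m := by
  -- `log J ≤ J^{1/5}` and `|A| J^{3/5} ≤ (c/2) J^{4/5}` for large `J`
  have h1 : ∀ᶠ J : ℝ in atTop, (1 : ℝ) * Real.log J ≤ J ^ (1 / 5 : ℝ) :=
    eventually_const_mul_log_le_rpow 1 (by norm_num)
  have h2 : ∀ᶠ J : ℝ in atTop, (2 * |A| / c) * J ^ (3 / 5 : ℝ) ≤ J ^ (4 / 5 : ℝ) :=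
    eventually_const_mul_rpow_le_rpow _ (by norm_num)
  filter_upwards [h1, h2, eventually_ge_atTop (Real.exp 1), eventually_ge_atTop (1 : ℝ)]
    with J hlog hpow hJe hJ1 m hm
  have hJ0 : 0 < J := by linarith
  have hlogJ1 : 1 ≤ Real.log J := by
    rw [← Real.log_exp 1]; exact Real.log_le_log (Real.exp_pos 1) hJe
  have hlogJ0 : 0 < Real.log J := by linarith
  -- `u := J^{-1/10} ∈ (0, 1]`
  set u : ℝ := J ^ (-(1 / 10 : ℝ)) with hu
  have hu0 : 0 < u := Real.rpow_pos_of_pos hJ0 _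
  have hu1 : u ≤ 1 := Real.rpow_le_one_of_one_le_of_nonpos hJ1 (by norm_num)
  refine le_trans ?_ (exp_half_mul_le_one_add_pow hu0.le hu1 m)
  rw [Real.exp_le_exp]
  -- `A log²J loglog J ≤ |A| log³ J ≤ |A| J^{3/5} ≤ (c/2) J^{4/5} ≤ m u / 2`
  have hll : Real.log (Real.log J) ≤ Real.log J :=
    (Real.log_le_sub_one_of_pos hlogJ0).trans (by linarith)
  have hlog3 : Real.log J ^ 3 ≤ J ^ (3 / 5 : ℝ) := by
    rw [one_mul] at hlog
    calc Real.log J ^ 3 ≤ (J ^ (1 / 5 : ℝ)) ^ 3 := pow_le_pow_left₀ hlogJ0.le hlog 3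
      _ = J ^ (3 / 5 : ℝ) := by rw [← Real.rpow_natCast, ← Real.rpow_mul hJ0.le]; norm_num
  have step1 : A * Real.log J ^ 2 * Real.log (Real.log J) ≤ |A| * Real.log J ^ 3 := by
    have hl2 : 0 ≤ Real.log J ^ 2 := sq_nonneg _
    calc A * Real.log J ^ 2 * Real.log (Real.log J)
        ≤ |A| * Real.log J ^ 2 * Real.log J := by
          have hll0 : 0 ≤ Real.log (Real.log J) := Real.log_nonneg hlogJ1
          calc A * Real.log J ^ 2 * Real.log (Real.log J)
              ≤ |A| * Real.log J ^ 2 * Real.log (Real.log J) := by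
                gcongr; exact le_abs_self A
            _ ≤ |A| * Real.log J ^ 2 * Real.log J := by gcongr
      _ = |A| * Real.log J ^ 3 := by ring
  have step2 : |A| * Real.log J ^ 3 ≤ (c / 2) * J ^ (4 / 5 : ℝ) := by
    have := mul_le_mul_of_nonneg_left hlog3 (abs_nonneg A)
    have hpow' : |A| * J ^ (3 / 5 : ℝ) ≤ (c / 2) * J ^ (4 / 5 : ℝ) := by
      have := mul_le_mul_of_nonneg_left hpow (show (0 : ℝ) ≤ c / 2 by linarith)
      calc |A| * J ^ (3 / 5 : ℝ) = (c / 2) * ((2 * |A| / c) * J ^ (3 / 5 : ℝ)) := by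
            field_simp
        _ ≤ (c / 2) * J ^ (4 / 5 : ℝ) := this
    exact this.trans hpow'
  have step3 : (c / 2) * J ^ (4 / 5 : ℝ) ≤ m * u / 2 := by
    -- `m u ≥ c J^{9/10} J^{-1/10} = c J^{4/5}`
    have e : J ^ (9 / 10 : ℝ) * u = J ^ (4 / 5 : ℝ) := by
      rw [hu, ← Real.rpow_add hJ0]; norm_num
    have : c * J ^ (4 / 5 : ℝ) ≤ m * u := by
      calc c * J ^ (4 / 5 : ℝ) = (c * J ^ (9 / 10 : ℝ)) * u := by rw [← e]; ring
        _ ≤ m * u := mul_le_mul_of_nonneg_right hm hu0.le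
    linarith
  linarith

/-! ## (ii) Monotonicity of `Q_I` in the index set -/

/-- **Monotonicity in the index set** (`Q_K ≤ Q_{K′}` for `K ⊆ K′`, used in «The contribution of
those `j` inside `K′` may be bounded by `Q_{K′} − Q_K ≤ J^{−0.1} Q_K`», FMP p. 39): for `g ≥ 0` on the off-diagonal
of `K′` and `K ⊆ K′`, `Σ_{(k,k′) ∈ K.offDiag} g k k′ ≤ Σ_{(k,k′) ∈ K′.offDiag} g k k′`.
[cite: RodgersTaoFMP2020, §8 proof of Prop. 15, FMP pp. 38–39] -/
theorem Finset.sum_offDiag_le_sum_offDiag_of_subset {α : Type*} [DecidableEq α] {K K' : Finset α}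
    (h : K ⊆ K') {g : α → α → ℝ} (hg : ∀ a ∈ K', ∀ b ∈ K', a ≠ b → 0 ≤ g a b) :
    ∑ p ∈ K.offDiag, g p.1 p.2 ≤ ∑ p ∈ K'.offDiag, g p.1 p.2 := by
  refine Finset.sum_le_sum_of_subset_of_nonneg (Finset.offDiag_mono h) fun p hp _ ↦ ?_
  rw [Finset.mem_offDiag] at hp
  exact hg _ hp.1 _ hp.2.1 hp.2.2

/-- Uncurried form (t4's assembly shape, rt/STATUS 2026-08-26T11:13:53Z): for `g : α × α → ℝ`
nonnegative and `K ⊆ K′`, `Σ_{p ∈ K.offDiag} g p ≤ Σ_{p ∈ K′.offDiag} g p`.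
[cite: RodgersTaoFMP2020, §8 proof of Prop. 15, FMP pp. 38–39] -/
theorem Finset.sum_offDiag_mono_of_nonneg {α : Type*} [DecidableEq α] {K K' : Finset α}
    (h : K ⊆ K') {g : α × α → ℝ} (hg : ∀ p, 0 ≤ g p) :
    ∑ p ∈ K.offDiag, g p ≤ ∑ p ∈ K'.offDiag, g p :=
  Finset.sum_le_sum_of_subset_of_nonneg (Finset.offDiag_mono h) fun p _ _ ↦ hg p

/-- Product-filter variant of `Finset.sum_offDiag_le_sum_offDiag_of_subset`:
`Σ_{(k,k′) ∈ K × K, k ≠ k′} ≤ Σ_{(k,k′) ∈ K′ × K′, k ≠ k′}` for `g ≥ 0`, `K ⊆ K′`.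
[cite: RodgersTaoFMP2020, §8 proof of Prop. 15, FMP pp. 38–39] -/
theorem Finset.sum_product_ne_le_of_subset {α : Type*} [DecidableEq α] {K K' : Finset α}
    (h : K ⊆ K') {g : α → α → ℝ} (hg : ∀ a ∈ K', ∀ b ∈ K', a ≠ b → 0 ≤ g a b) :
    ∑ p ∈ (K ×ˢ K).filter (fun p ↦ p.1 ≠ p.2), g p.1 p.2 ≤
      ∑ p ∈ (K' ×ˢ K').filter (fun p ↦ p.1 ≠ p.2), g p.1 p.2 := by
  refine Finset.sum_le_sum_of_subset_of_nonneg ?_ fun p hp _ ↦ ?_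
  · intro p hp
    simp only [Finset.mem_filter, Finset.mem_product] at hp ⊢
    exact ⟨⟨h hp.1.1, h hp.1.2⟩, hp.2⟩
  · simp only [Finset.mem_filter, Finset.mem_product] at hp
    exact hg _ hp.1.1 _ hp.1.2 hp.2

/-- Ordered-pairs variant (`k < k′`): `Σ_{(k,k′) ∈ K × K, k < k′} ≤ Σ_{(k,k′) ∈ K′ × K′, k < k′}`
for `g ≥ 0`, `K ⊆ K′`. [cite: RodgersTaoFMP2020, §8 proof of Prop. 15, FMP pp. 38–39] -/
theorem Finset.sum_product_lt_le_of_subset {α : Type*} [LinearOrder α] {K K' : Finset α}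
    (h : K ⊆ K') {g : α → α → ℝ} (hg : ∀ a ∈ K', ∀ b ∈ K', a < b → 0 ≤ g a b) :
    ∑ p ∈ (K ×ˢ K).filter (fun p ↦ p.1 < p.2), g p.1 p.2 ≤
      ∑ p ∈ (K' ×ˢ K').filter (fun p ↦ p.1 < p.2), g p.1 p.2 := by
  refine Finset.sum_le_sum_of_subset_of_nonneg ?_ fun p hp _ ↦ ?_
  · intro p hp
    simp only [Finset.mem_filter, Finset.mem_product] at hp ⊢
    exact ⟨⟨h hp.1.1, h hp.1.2⟩, hp.2⟩
  · simp only [Finset.mem_filter, Finset.mem_product] at hp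
    exact hg _ hp.1.1 _ hp.1.2 hp.2

/-- Integrated monotonicity: `∫_{a}^{b} Σ_{K.offDiag} g_t ≤ ∫_{a}^{b} Σ_{K′.offDiag} g_t` for
`a ≤ b`, `K ⊆ K′`, `g_t ≥ 0` off the diagonal of `K′` for `t ∈ [a,b]`, both sides integrable —
the `Q_K ≤ Q_{K′}` of FMP pp. 38–39. [cite: RodgersTaoFMP2020, §8 proof of Prop. 15, FMP pp. 38–39] -/
theorem intervalIntegral_sum_offDiag_mono {α : Type*} [DecidableEq α] {K K' : Finset α}
    (h : K ⊆ K') {g : ℝ → α → α → ℝ} {a b : ℝ} (hab : a ≤ b)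
    (hg : ∀ t ∈ Icc a b, ∀ x ∈ K', ∀ y ∈ K', x ≠ y → 0 ≤ g t x y)
    (hK : IntervalIntegrable (fun t ↦ ∑ p ∈ K.offDiag, g t p.1 p.2) volume a b)
    (hK' : IntervalIntegrable (fun t ↦ ∑ p ∈ K'.offDiag, g t p.1 p.2) volume a b) :
    ∫ t in a..b, ∑ p ∈ K.offDiag, g t p.1 p.2 ≤ ∫ t in a..b, ∑ p ∈ K'.offDiag, g t p.1 p.2 := by
  refine intervalIntegral.integral_mono_on hab hK hK' fun t ht ↦ ?_
  exact Finset.sum_offDiag_le_sum_offDiag_of_subset h (hg t ht)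

/-! ## (iii) The crude lower bound skeleton -/

/-- **Crude lower-bound skeleton** («From (add) we have a crude lower bound
`Q_{[J,2J]_{ℤ*}} ≫ J log^{−O(1)} J`», FMP p. 38): if the gaps satisfy `0 < d_k ≤ G` for `k ∈ S`, then
`|S| / G² ≤ Σ_{k ∈ S} d_k^{−2}`. Apply with `d_k = x_{k+1}(t) − x_k(t)` over the consecutive pairs
of a block and `G = C log J`. [cite: RodgersTaoFMP2020, §8 proof of Prop. 15, FMP p. 38] -/
theorem Finset.card_div_sq_le_sum_inv_sq {ι : Type*} (S : Finset ι) {d : ι → ℝ} {G : ℝ}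
    (hG : 0 < G) (hd : ∀ k ∈ S, 0 < d k ∧ d k ≤ G) :
    (S.card : ℝ) / G ^ 2 ≤ ∑ k ∈ S, (d k ^ 2)⁻¹ := by
  have : ∀ k ∈ S, (G ^ 2)⁻¹ ≤ (d k ^ 2)⁻¹ := by
    intro k hk
    obtain ⟨h0, hle⟩ := hd k hk
    rw [inv_le_inv₀ (by positivity) (by positivity)]
    exact pow_le_pow_left₀ h0.le hle 2
  calc (S.card : ℝ) / G ^ 2 = ∑ _k ∈ S, (G ^ 2)⁻¹ := by
        rw [Finset.sum_const, nsmul_eq_mul]; ring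
    _ ≤ ∑ k ∈ S, (d k ^ 2)⁻¹ := Finset.sum_le_sum this

/-- Integrated crude lower bound: if for every `t ∈ [a,b]` (`a ≤ b`) the gaps satisfy
`0 < d_k(t) ≤ G` (`k ∈ S`) and the sum is integrable, then
`(b − a) · |S| / G² ≤ ∫_a^b Σ_{k ∈ S} d_k(t)^{−2} dt`.
[cite: RodgersTaoFMP2020, §8 proof of Prop. 15, FMP p. 38] -/
theorem intervalIntegral_card_div_sq_le {ι : Type*} (S : Finset ι) {d : ℝ → ι → ℝ} {G a b : ℝ}
    (hab : a ≤ b) (hG : 0 < G) (hd : ∀ t ∈ Icc a b, ∀ k ∈ S, 0 < d t k ∧ d t k ≤ G)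
    (hint : IntervalIntegrable (fun t ↦ ∑ k ∈ S, (d t k ^ 2)⁻¹) volume a b) :
    (b - a) * ((S.card : ℝ) / G ^ 2) ≤ ∫ t in a..b, ∑ k ∈ S, (d t k ^ 2)⁻¹ := by
  have h := intervalIntegral.integral_mono_on hab intervalIntegrable_const hint
    (fun t ht ↦ Finset.card_div_sq_le_sum_inv_sq S hG (hd t ht))
  rwa [intervalIntegral.integral_const, smul_eq_mul] at h

/-- The consequence used on p. 39 («The contribution of those `j` inside `K′` may be bounded by
`Q_{K′} − Q_K ≤ J^{−0.1} Q_K`, thanks to (pig)»): from `Q′ ≤ (1+ε) Q`,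
`Q′ − Q ≤ ε Q`. [cite: RodgersTaoFMP2020, §8 proof of Prop. 15, FMP p. 39] -/
theorem sub_le_mul_of_le_one_add_mul {Q Q' ε : ℝ} (h : Q' ≤ (1 + ε) * Q) : Q' - Q ≤ ε * Q := by
  linarith

end Literature.NumberTheory.LFunctions

end
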